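import Literature.NumberTheory.EllipticCurves.ThreeKernelCocycles
import Literature.NumberTheory.EllipticCurves.MordellCurveThreeDescentLocal
import Literature.NumberTheory.EllipticCurves.ShaRestriction
import Literature.NumberTheory.NumberFields.EisensteinField
import HarnessLib

/-!
# A cubic character of `Γ_ℚ`, restricted to `ℚ(ζ₃)`, is the Kummer character of an element of cube norm
# (the norm condition `G₃ = {u ∈ K*/K*³ : N(u) ∈ ℚ*³}` of Cohen–Pazuki 2009, Definition 1.3)

Topic `NumberTheory/EllipticCurves`. In Cohen–Pazuki's `3`-descent [CohenPazuki2009, §1] the descent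
map of a curve with a RATIONAL `3`-torsion point but irrational dual kernel takes values in «the
subgroup `G₃` of classes of elements of `K*/K*³` whose norm is a cube», `K = ℚ(√−3)` (Definition 1.3).
Cohomologically: `H¹(ℚ, ℤ/3) = Hom(Γ_ℚ, ℤ/3)` injects by restriction into
`H¹(K, ℤ/3) = H¹(K, μ₃) = K*/K*³`, with image inside `G₃`. This file proves that statement in the
tree's currency (`K3 = ℚ(ζ₃)` of `EisensteinField`, `MordellDescent.kummerExp`, the restriction
`resGal : Γ_{K3} → Γ_ℚ` of `Sha.lean`):

* `conjAut τ` — the conjugate `c ∘ τ ∘ c⁻¹ ∈ Γ_{K3}` of `τ ∈ Γ_{K3}` by the lift `c = K3.conjBar` of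
  complex conjugation to `K̄3`; `kummerExp_conjAut`: `κ_u(c τ c⁻¹) = −κ_{ū}(τ)`;
  **`exists_norm_eq_cube_of_kummerExp_conjAut`**: if `κ_u` is invariant under `τ ↦ c τ c⁻¹` then
  `N(u) = u ū` is a rational cube.
* `sigmaTilde ∈ Γ_ℚ` — conjugation transported to `ℚ̄` along the chosen embedding
  `ι = closureEmb : ℚ̄ → K̄3`; `resGal_conjAut`: `res(c τ c⁻¹) = σ̃ · res(τ) · σ̃⁻¹`, so every
  HOMOMORPHISM `n : Γ_ℚ → ℤ/3` satisfies `n(res(c τ c⁻¹)) = n(res τ)` (`hom_resGal_conjAut`).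
* **`exists_kummerExp_eq_resGal_and_norm_eq_cube`** — for every locally constant homomorphism
  `n : Γ_ℚ → ℤ/3ℤ` there is `u ∈ K3*` with `κ_u = n ∘ res` on `Γ_{K3}` and `N(u) ∈ ℚ*³`
  (Kummer theory over `K3 ∋ √−3`, `ThreeKernelCocycles`, plus the above).

## References

* [CohenPazuki2009] H. Cohen, F. Pazuki, Acta Arith. 140 (2009), Definition 1.3 (`G₃`), Prop. 1.4.
* [SilvermanAEC2009] J. H. Silverman, *AEC*, VIII.§2, X.§4 (Kummer theory, restriction).
* Tree: `EisensteinField` (`K3`, `conj`, `conjBar`), `Sha` (`closureEmb`, `resGal`),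
  `ShaRestriction` (`algEquivOfEmb`), `MordellCurveThreeDescentLocal` (`iotaE_galAut_resGal`).
-/

noncomputable section

open scoped Classical

namespace Literature.NumberTheory.EllipticCurves

namespace CPMuDescent

open MordellDescent Literature.NumberTheory.NumberFields Literature.NumberTheory.NumberFields.K3

/-! ## `√−3 ∈ K3`: the cyclotomic sign is trivial on `Γ_{K3}`; conjugation on `√−3`, `ω` -/

/-- `√−3 ∈ K3` (as `MordellDescent.theta K3 ∈ K̄3`). [cite: CohenPazuki2009, §1.2] -/
theorem theta_K3_mem_range : theta K3 ∈ Set.range (algebraMap K3 (AlgebraicClosure K3)) :=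
  theta_mem_range_of_sq K3.theta_sq

/-- `MordellDescent.theta K3 = ± θ̄` for the tree's `K3.theta = 2ζ + 1`. [cite: CohenPazuki2009, §1.2] -/
theorem theta_K3_eq_or : theta K3 = algebraMap K3 (AlgebraicClosure K3) K3.theta ∨
    theta K3 = -algebraMap K3 (AlgebraicClosure K3) K3.theta := by
  have h : theta K3 ^ 2 = (algebraMap K3 (AlgebraicClosure K3) K3.theta) ^ 2 := by
    rw [MordellDescent.theta_sq, ← map_pow, K3.theta_sq, map_neg, map_ofNat]
  exact sq_eq_sq_iff_eq_or_eq_neg.mp h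

/-- `conjBar (√−3) = −√−3`. [cite: CohenPazuki2009, §1.2] -/
theorem conjBar_thetaMD : conjBar (theta K3) = -theta K3 := by
  rcases theta_K3_eq_or with h | h <;> rw [h]
  · exact conjBar_theta
  · rw [map_neg, conjBar_theta]

/-- `conjBar⁻¹ (√−3) = −√−3`. [cite: CohenPazuki2009, §1.2] -/
theorem conjBar_symm_thetaMD : conjBar.symm (theta K3) = -theta K3 := by
  apply conjBar.injective
  rw [RingEquiv.apply_symm_apply, map_neg, conjBar_thetaMD, neg_neg]

/-- `conjBar ω = ω²`. [cite: CohenPazuki2009, §1.2] -/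
theorem conjBar_omega : conjBar (omega K3) = omega K3 ^ 2 := by
  rw [omega_sq, omega, map_div₀, map_sub, map_one, map_ofNat, conjBar_thetaMD]

/-- `conjBar⁻¹ ω = ω²`. [cite: CohenPazuki2009, §1.2] -/
theorem conjBar_symm_omega : conjBar.symm (omega K3) = omega K3 ^ 2 := by
  rw [omega_sq, omega, map_div₀, map_sub, map_one, map_ofNat, conjBar_symm_thetaMD]

/-- `conjBar⁻¹` restricts to `conj` (an involution). [cite: CohenPazuki2009, §1.2] -/
theorem conjBar_symm_algebraMap (x : K3) :
    conjBar.symm (algebraMap K3 (AlgebraicClosure K3) x) = algebraMap K3 _ (K3.conj x) := by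
  apply conjBar.injective
  rw [RingEquiv.apply_symm_apply, conjBar_algebraMap, K3.conj_apply, K3.conj_apply, star_star]

/-! ## The conjugate `c τ c⁻¹` of `τ ∈ Γ_{K3}` -/

/-- **The conjugate `c ∘ τ ∘ c⁻¹ ∈ Γ_{K3}`** of `τ ∈ Γ_{K3}` by the lift `c = conjBar` of complex
conjugation (again `K3`-linear, since `c` restricts to the involution `conj` of `K3`).
[cite: CohenPazuki2009, Definition 1.3 (G₃)] -/
def conjAut (τ : Field.absoluteGaloisGroup K3) : Field.absoluteGaloisGroup K3 :=
  AlgEquiv.ofRingEquiv (f := conjBar.symm.trans ((galAutE K3 τ).toRingEquiv.trans conjBar)) fun x => by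
    change conjBar (galAutE K3 τ (conjBar.symm (algebraMap K3 _ x))) = algebraMap K3 _ x
    rw [conjBar_symm_algebraMap, AlgEquiv.commutes, conjBar_algebraMap, K3.conj_apply, K3.conj_apply,
      star_star]

/-- `(c τ c⁻¹)(x) = c (τ (c⁻¹ x))`. [cite: CohenPazuki2009, Definition 1.3 (G₃)] -/
theorem conjAut_apply (τ : Field.absoluteGaloisGroup K3) (x : AlgebraicClosure K3) :
    galAut (conjAut τ) x = conjBar (galAut τ (conjBar.symm x)) := rfl

/-- **`κ_u(c τ c⁻¹) = −κ_{ū}(τ)`** for `u ∈ K3*`: with `c⁻¹ ∛u = ω^j ∛ū`,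
`c τ c⁻¹ (∛u) = c(ω^{j + κ_ū(τ)} ∛ū) = ω^{2κ_ū(τ)} ∛u`. [cite: CohenPazuki2009, Definition 1.3 (G₃)] -/
theorem kummerExp_conjAut {u : K3} (hu : u ≠ 0) (τ : Field.absoluteGaloisGroup K3) :
    kummerExp u (conjAut τ) = -kummerExp (K3.conj u) τ := by
  have hu' : K3.conj u ≠ 0 := (map_ne_zero K3.conj).mpr hu
  set ρ := cubeRoot u with hρ
  set ρ' := cubeRoot (K3.conj u) with hρ'
  have hρ'0 : ρ' ≠ 0 := cubeRoot_ne_zero hu'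
  -- `c⁻¹ ρ = ω^j ρ'`
  obtain ⟨j, -, hj⟩ : ∃ j < 3, omega K3 ^ j = conjBar.symm ρ / ρ' := by
    apply exists_pow_eq_of_pow_three_eq_one K3
    rw [div_pow, ← map_pow, hρ, cubeRoot_pow_three, conjBar_symm_algebraMap, hρ', cubeRoot_pow_three,
      div_self]
    rw [map_ne_zero_iff _ (algebraMap K3 (AlgebraicClosure K3)).injective]; exact hu'
  have hcρ : conjBar.symm ρ = omega K3 ^ j * ρ' := by rw [hj, div_mul_cancel₀ _ hρ'0]
  have hcρ' : conjBar ρ' = omega K3 ^ j * ρ := by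
    have h1 : ρ = conjBar (omega K3 ^ j * ρ') := by rw [← hcρ, RingEquiv.apply_symm_apply]
    rw [map_mul, map_pow, conjBar_omega, ← pow_mul] at h1
    -- `ρ = ω^{2j} c(ρ')`, so `c(ρ') = ω^{j} ρ` (`ω^{3j} = 1`)
    have hω3 := omega_pow_three K3
    calc conjBar ρ' = omega K3 ^ (3 * j) * conjBar ρ' := by rw [pow_mul, hω3, one_pow, one_mul]
      _ = omega K3 ^ j * (omega K3 ^ (2 * j) * conjBar ρ') := by rw [← mul_assoc, ← pow_add]; ring_nf
      _ = omega K3 ^ j * ρ := by rw [← h1]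
  -- `τ` fixes `ω`
  have hτω : galAut τ (omega K3) = omega K3 := by
    rw [galAut_omega, epsNat, if_pos (galAut_theta_of_mem_range theta_K3_mem_range τ), pow_one]
  -- the computation
  set k := (kummerExp (K3.conj u) τ).val with hk
  have key : galAut (conjAut τ) ρ = omega K3 ^ (2 * k) * ρ := by
    rw [conjAut_apply, hcρ, map_mul, map_pow, hτω, hρ', galAut_cubeRoot hu', ← hk, ← hρ', map_mul, map_mul,
      map_pow, map_pow, conjBar_omega, hcρ']
    have hω3 := omega_pow_three K3
    calc (omega K3 ^ 2) ^ j * ((omega K3 ^ 2) ^ k * (omega K3 ^ j * ρ))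
        = (omega K3 ^ 3) ^ j * (omega K3 ^ (2 * k)) * ρ := by ring
      _ = omega K3 ^ (2 * k) * ρ := by rw [hω3, one_pow, one_mul]
  rw [hρ] at key
  rw [kummerExp_eq_of_galAut_eq hu key]
  push_cast
  rw [hk, ZMod.natCast_zmod_val]
  have h3 : (2 : ZMod 3) = -1 := by decide
  rw [h3]; ring

/-- **The norm condition.** If the Kummer character `κ_u` of `u ∈ K3*` is invariant under
`τ ↦ c τ c⁻¹` then `N(u) = u ū` is a rational cube: `κ_{u ū} = κ_u + κ_ū = 0` on `Γ_{K3}`, so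
`u ū = w³` with `w ∈ K3`, and `w³ ∈ ℚ` forces `w³ ∈ ℚ*³` (`N(w)³ = (w³)²`).
[cite: CohenPazuki2009, Definition 1.3 (G₃)] -/
theorem exists_norm_eq_cube_of_kummerExp_conjAut {u : K3} (hu : u ≠ 0)
    (h : ∀ τ : Field.absoluteGaloisGroup K3, kummerExp u (conjAut τ) = kummerExp u τ) :
    ∃ r : ℚ, QuadraticAlgebra.norm u = r ^ 3 := by
  have hu' : K3.conj u ≠ 0 := (map_ne_zero K3.conj).mpr hu
  have hzero : ∀ τ : Field.absoluteGaloisGroup K3, kummerExp (u * K3.conj u) τ = 0 := by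
    intro τ
    rw [kummerExp_mul_of_theta_mem_range theta_K3_mem_range hu hu', ← h τ, kummerExp_conjAut hu τ,
      neg_add_cancel]
  obtain ⟨w, hw0, hw⟩ := exists_eq_cube_of_kummerExp_eq_zero (mul_ne_zero hu hu') hzero
  -- `N(u) = u ū = w³`, and `N(w)³ = N(w³) = N(N(u)) = N(u)²`
  set N := QuadraticAlgebra.norm u with hN
  have hNu : ((N : ℚ) : K3) = w ^ 3 := by
    have e := QuadraticAlgebra.algebraMap_norm_eq_mul_star u
    rw [eq_ratCast] at e
    rw [hN, e, ← hw, K3.conj_apply]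
  have hN0 : N ≠ 0 := by
    intro h0; rw [h0, Rat.cast_zero] at hNu; exact pow_ne_zero 3 hw0 hNu.symm
  have hNw : QuadraticAlgebra.norm w ^ 3 = N ^ 2 := by
    rw [← map_pow, ← hNu, QuadraticAlgebra.norm_def, K3.ratCast_re, K3.ratCast_im]
    ring
  refine ⟨QuadraticAlgebra.norm w ^ 2 / N, ?_⟩
  rw [div_pow, ← pow_mul, show 2 * 3 = 3 * 2 by rfl, pow_mul, hNw]
  field_simp

/-! ## Conjugation transported to `Γ_ℚ` and the restriction `Γ_{K3} → Γ_ℚ` -/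

/-- `conjBar` as a `ℚ`-algebra automorphism of `K̄3`. [cite: CohenPazuki2009, Definition 1.3 (G₃)] -/
def conjBarRat : AlgebraicClosure K3 ≃ₐ[ℚ] AlgebraicClosure K3 :=
  AlgEquiv.ofRingEquiv (f := conjBar) fun q => by
    rw [IsScalarTower.algebraMap_apply ℚ K3 (AlgebraicClosure K3), conjBar_algebraMap,
      eq_ratCast (algebraMap ℚ K3), K3.conj_ratCast]

/-- `conjBarRat x = conjBar x`. [cite: CohenPazuki2009, Definition 1.3 (G₃)] -/
@[simp] theorem conjBarRat_apply (x : AlgebraicClosure K3) : conjBarRat x = conjBar x := rfl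

/-- **Complex conjugation as an element `σ̃ ∈ Γ_ℚ`**, transported to `ℚ̄` along the chosen
embedding `ι : ℚ̄ ≃ K̄3` (`closureEmb`, bijective by `algEquivOfEmb`): `σ̃ = ι⁻¹ ∘ c ∘ ι`.
[cite: CohenPazuki2009, Definition 1.3 (G₃)] -/
def sigmaTilde : Field.absoluteGaloisGroup ℚ :=
  ((algEquivOfEmb K3 (iotaE (K := ℚ) K3)).trans conjBarRat).trans (algEquivOfEmb K3 (iotaE (K := ℚ) K3)).symm

/-- `ι (σ̃ x) = c (ι x)`. [cite: CohenPazuki2009, Definition 1.3 (G₃)] -/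
theorem iotaE_sigmaTilde (x : AlgebraicClosure ℚ) :
    iotaE (K := ℚ) K3 (galAut sigmaTilde x) = conjBar (iotaE (K := ℚ) K3 x) := by
  change iotaE (K := ℚ) K3 ((algEquivOfEmb K3 (iotaE (K := ℚ) K3)).symm
    (conjBarRat (algEquivOfEmb K3 (iotaE (K := ℚ) K3) x))) = _
  rw [← algEquivOfEmb_apply K3 (iotaE (K := ℚ) K3), AlgEquiv.apply_symm_apply, conjBarRat_apply,
    algEquivOfEmb_apply]

/-- `ι (σ̃⁻¹ x) = c⁻¹ (ι x)`. [cite: CohenPazuki2009, Definition 1.3 (G₃)] -/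
theorem iotaE_sigmaTilde_inv (x : AlgebraicClosure ℚ) :
    iotaE (K := ℚ) K3 (galAut sigmaTilde⁻¹ x) = conjBar.symm (iotaE (K := ℚ) K3 x) := by
  apply conjBar.injective
  rw [RingEquiv.apply_symm_apply, ← iotaE_sigmaTilde, ← galAut_mul_apply, mul_inv_cancel]
  rfl

/-- **`res(c τ c⁻¹) = σ̃ · res(τ) · σ̃⁻¹`** in `Γ_ℚ` (checked after `ι`, which is injective:
both sides send `ι x` to `c(τ(c⁻¹(ι x)))`). [cite: CohenPazuki2009, Definition 1.3 (G₃)] -/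
theorem resGal_conjAut (τ : Field.absoluteGaloisGroup K3) :
    resGal (K := ℚ) K3 (conjAut τ) = sigmaTilde * resGal (K := ℚ) K3 τ * sigmaTilde⁻¹ := by
  apply AlgEquiv.ext
  intro x
  apply (iotaE (K := ℚ) K3).injective
  change iotaE (K := ℚ) K3 (galAut (resGal (K := ℚ) K3 (conjAut τ)) x) =
    iotaE (K := ℚ) K3 (galAut (sigmaTilde * resGal (K := ℚ) K3 τ * sigmaTilde⁻¹) x)
  rw [iotaE_galAut_resGal, galAut_mul_apply, galAut_mul_apply, iotaE_sigmaTilde, iotaE_galAut_resGal,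
    iotaE_sigmaTilde_inv]
  rfl

/-- Hence **every homomorphism `n : Γ_ℚ → ℤ/3ℤ` satisfies `n(res(c τ c⁻¹)) = n(res τ)`**.
[cite: CohenPazuki2009, Definition 1.3 (G₃)] -/
theorem hom_resGal_conjAut (n : Field.absoluteGaloisGroup ℚ → ZMod 3) (hn : ∀ σ τ, n (σ * τ) = n σ + n τ)
    (τ : Field.absoluteGaloisGroup K3) :
    n (resGal (K := ℚ) K3 (conjAut τ)) = n (resGal (K := ℚ) K3 τ) := by
  have h1 : n 1 = 0 := by
    have := hn 1 1; rw [mul_one] at this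
    exact add_eq_left.mp this.symm
  have hinv : n sigmaTilde⁻¹ = -n sigmaTilde := by
    have := hn sigmaTilde sigmaTilde⁻¹; rw [mul_inv_cancel, h1] at this
    linear_combination (-1 : ZMod 3) * this
  rw [resGal_conjAut, hn, hn, hinv]; ring

/-! ## The restricted character is the Kummer character of an element of cube norm -/

/-- **`Hom(Γ_ℚ, ℤ/3) → G₃ ⊂ K3*/K3*³`.** For every locally constant homomorphism `n : Γ_ℚ → ℤ/3ℤ`
there is `u ∈ K3*` whose Kummer character is `n ∘ res` on `Γ_{K3}` and whose norm is a rational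
cube (Cohen–Pazuki's «classes whose norm is a cube», Definition 1.3).
[cite: CohenPazuki2009, Definition 1.3 (G₃) and Proposition 1.4 (2)] -/
theorem exists_kummerExp_eq_resGal_and_norm_eq_cube (n : Field.absoluteGaloisGroup ℚ → ZMod 3)
    (hn : ∀ σ τ, n (σ * τ) = n σ + n τ) (hlc : IsLocallyConstant n) :
    ∃ (u : K3) (_ : u ≠ 0), (∀ τ : Field.absoluteGaloisGroup K3, kummerExp u τ = n (resGal (K := ℚ) K3 τ)) ∧
      ∃ r : ℚ, QuadraticAlgebra.norm u = r ^ 3 := by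
  set n₃ : Field.absoluteGaloisGroup K3 → ZMod 3 := fun τ => n (resGal (K := ℚ) K3 τ) with hn₃
  have hn₃mul : ∀ σ τ, n₃ (σ * τ) = n₃ σ + n₃ τ := fun σ τ => by
    simp only [hn₃, map_mul, hn]
  have hlc₃ : IsLocallyConstant n₃ := hlc.comp_continuous (resGal (K := ℚ) K3).continuous
  obtain ⟨u, hu, hκ⟩ := exists_kummerExp_eq_of_theta_mem_range theta_K3_mem_range n₃ hn₃mul hlc₃
  refine ⟨u, hu, hκ, exists_norm_eq_cube_of_kummerExp_conjAut hu fun τ => ?_⟩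
  rw [hκ, hκ]
  exact hom_resGal_conjAut n hn τ

end CPMuDescent

end Literature.NumberTheory.EllipticCurves

end
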